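import Summits.BirchSwinnertonDyer.BirchSwinnertonDyer.Theorems.ManinLocalTwoThreeQuarterShiftGamma1Orbit
import Literature.NumberTheory.EllipticCurves.ManinConstantGamma1Gamma0LedgerProofs
import HarnessLib

/-!
# STEVENS-SIDE RIGIDITY along `χ₋₄` edges: the `X₁(N′)`-optimal curve of the twisted class is the `χ₋₄`-twist of the `X₁(N)`-optimal curve,
# `c₁′¹²·Δ(W₁′) = c₁¹²·Δ(W₁)`, and `|c₁′| = |c₁|` when the discriminants agree (unconditional, given the data)
(route `ManinLocalTwoThree`, deciding crux C2 `ManinOddAtFour` stmt-BirchSwinnertonDyer-22967; cell bsd-f2-manin, C2/C3 LEAD p1 gen 18;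
`--supports stmt-BirchSwinnertonDyer-22967`; sequel to `…QuarterShiftGamma1` / `…QuarterShiftGamma1Orbit` (the `Γ₁` rotation
`Λ₁(f_{D′}) = i·Λ₁(f_D)` along every `χ₋₄` edge `N ∣ N′ ∣ 4N`, `16 ∣ N′`))

an's §22 / es's §55.4 proved, for LATTICE-OPTIMAL `X₀`-data, that a rotation `Λ₀(f_{D′}) = i·Λ₀(f_D)` forces `W′ ≅ W ⊗ χ₋₄` over `ℚ`
(`optimalTwistRigidity_of_rotation`) and the Manin–discriminant identity `c′¹²Δ′ = c¹²Δ`.  The argument only uses «Néron lattice =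
`c`·(period lattice)», so it runs VERBATIM for Stevens' OPTIMAL `X₁(N)`-data (`Gamma1ParametrizationData.IsOptimal`: `Λ_{W₁} = c₁·Λ₁(f)`)
with `Λ₀` replaced by `Λ₁`:
* §7 (rotation as hypothesis) `gamma1_neronLattice_eq_mulLeft_of_rotation`, **`gamma1OptimalTwistRigidity_of_rotation`** (`W₁′ ≅ W₁ ⊗ χ₋₄`),
  **`gamma1_c_pow_twelve_mul_Δ_eq_of_rotation`** (`c₁′¹²·Δ(W₁′) = c₁¹²·Δ(W₁)`), `gamma1_maninConstant_natAbs_eq_of_rotation` (`Δ` equal ⟹ `|c₁′| = |c₁|`);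
* §8 (the `χ₋₄` edge) for `X₀`-data `D, D′` of `W, W′ ~ W ⊗ χ₋₄` at `N ∣ N′ ∣ 4N`, `16 ∣ N′` (both additive at `2`) and OPTIMAL `X₁`-data `D₁, D₁′`
  of isogenous globally minimal `W₁ ~ W`, `W₁′ ~ W′`: **`stevensOptimalTwistRigidity_of_negOne_twist_of_dvd`** (`W₁′ ≅ W₁ ⊗ χ₋₄`: Stevens'
  curve of the twisted class IS the twist of Stevens' curve), **`gamma1_c_pow_twelve_mul_Δ_eq_of_negOne_twist_of_dvd`**,
  **`gamma1_maninConstant_natAbs_eq_of_negOne_twist_of_dvd`** (`Δ(W₁′) = Δ(W₁)` ⟹ `|c₁′| = |c₁|`: the `Γ₁`-constant — Stevens' `c₁ = ±1`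
  conjecture, whose `2`-part is C2's stub 6♭‴ in Kato clothing — is CONSTANT along `χ₋₄` edges modulo the local discriminant clause,
  exactly like es's `|c₀′| = |c₀|` modulo E-es-166).
HONEST FRAMING: unconditional theorems GIVEN the data (existence of optimal `X₁`-data is the printed stub F-need/CES); the discriminant clause
is NOT proved here (es's LAW E-es-166 covers minimal models additive at `2`); Stevens' conjecture, C2, Manin's conjecture and BSD are NOT proved.
No definitions, no named facts, no sorry.
[cite: Stevens1989, §2 (X₁(N)-optimal curves; Conj. c₁ = ±1) and Lemma (5.4) p. 97] [cite: Shimura1971, Prop. 3.64]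
-/

set_option autoImplicit false
-- lint-debt: the directory name repeats the summit name (sibling precedent `ManinLocalTwoThreeQuarterShiftGamma1.lean`)
set_option linter.dupNamespace false

noncomputable section

open scoped MatrixGroups ModularForm Pointwise
open CongruenceSubgroup Complex
open WeierstrassCurve Literature.NumberTheory.DiophantineGeometry Literature.NumberTheory.EllipticCurves
  Literature.NumberTheory.EllipticCurves.ModularForms
open Summit.BirchSwinnertonDyer.Rank1Residual.ManinAdditive (IsLatticeOptimal)

namespace Summit.BirchSwinnertonDyer.BirchSwinnertonDyer.Theorems.ManinLocalTwoThree.SigmaHabitat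

/-! ## §7 Stevens-side rigidity FROM A `Γ₁` ROTATION (an §22 / es §55.4 with `Λ₀ ↦ Λ₁`, lattice-optimal ↦ `IsOptimal`) -/

section Rotation

variable {W₁ W₁' : WeierstrassCurve ℚ} {N N' : ℕ} [NeZero N] [NeZero N']

/-- `(c : ℂ) ≠ 0` for an `X₁(N)`-datum. -/
theorem gamma1_cast_c_ne_zero (D₁ : Gamma1ParametrizationData W₁ N) : (D₁.c : ℂ) ≠ 0 :=
  Int.cast_ne_zero.mpr D₁.maninConstant_ne_zero

/-- Lattice bookkeeping from a `Γ₁` rotation `Λ₁(f_{D₁′}) = i·Λ₁(f_{D₁})` with OPTIMAL `D₁`, `D₁′`: `Λ_{W₁′} = (c₁′/c₁)·(i⁻¹Λ_{W₁})`. -/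
theorem gamma1_neronLattice_eq_mulLeft_of_rotation (D₁ : Gamma1ParametrizationData W₁ N)
    (D₁' : Gamma1ParametrizationData W₁' N') (h₁ : D₁.IsOptimal) (h₁' : D₁'.IsOptimal)
    (hrot : ∀ z : ℂ, z ∈ periodLatticeGamma1 D₁'.f ↔ Complex.I * z ∈ periodLatticeGamma1 D₁.f)
    (hl0 : ((D₁'.c : ℂ) / (D₁.c : ℂ)) ≠ 0) :
    D₁'.L.lattice = ((D₁.L.mulLeft (Complex.I)⁻¹ (inv_ne_zero Complex.I_ne_zero)).mulLeft
      ((D₁'.c : ℂ) / (D₁.c : ℂ)) hl0).lattice := by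
  have hc0 : (D₁.c : ℂ) ≠ 0 := gamma1_cast_c_ne_zero D₁
  have hc0' : (D₁'.c : ℂ) ≠ 0 := gamma1_cast_c_ne_zero D₁'
  ext z
  rw [PeriodPair.mem_mulLeft_lattice, PeriodPair.mem_mulLeft_lattice, inv_inv, inv_div,
    show Complex.I * ((D₁.c : ℂ) / (D₁'.c : ℂ) * z) = (D₁.c : ℂ) * (Complex.I * ((D₁'.c : ℂ)⁻¹ * z)) by
      rw [div_eq_mul_inv]; ring]
  constructor
  · intro hz
    obtain ⟨w, hw, rfl⟩ := h₁' z hz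
    rw [inv_mul_cancel_left₀ hc0']
    exact D₁.smul_periodLatticeGamma1_le _ ((hrot w).mp hw)
  · intro hz
    obtain ⟨w, hw, hEq⟩ := h₁ _ hz
    have hw' : Complex.I * ((D₁'.c : ℂ)⁻¹ * z) = w := mul_left_cancel₀ hc0 hEq
    have hmem : (D₁'.c : ℂ)⁻¹ * z ∈ periodLatticeGamma1 D₁'.f := (hrot _).mpr (hw' ▸ hw)
    have := D₁'.smul_periodLatticeGamma1_le _ hmem
    rwa [mul_inv_cancel_left₀ hc0'] at this

/-- **Stevens-side optimal rigidity from a `Γ₁` rotation**: OPTIMAL `X₁`-data `D₁`, `D₁′` with `Λ₁(f_{D₁′}) = i·Λ₁(f_{D₁})` ⟹ `W₁′ ≅ W₁ ⊗ χ₋₄`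
over `ℚ` (the Néron lattices are homothetic by a rational scalar times `i⁻¹`). [cite: Stevens1989, §2] -/
theorem gamma1OptimalTwistRigidity_of_rotation [W₁.IsElliptic] [W₁'.IsElliptic] (D₁ : Gamma1ParametrizationData W₁ N)
    (D₁' : Gamma1ParametrizationData W₁' N') (h₁ : D₁.IsOptimal) (h₁' : D₁'.IsOptimal)
    (hrot : ∀ z : ℂ, z ∈ periodLatticeGamma1 D₁'.f ↔ Complex.I * z ∈ periodLatticeGamma1 D₁.f) :
    ∃ u : VariableChange ℚ, u • W₁.quadraticTwist ((-1 : ℤ) : ℚ) = W₁' := by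
  classical
  have hd0 : ((-1 : ℤ) : ℚ) ≠ 0 := by norm_num
  haveI := W₁.isElliptic_quadraticTwist hd0
  have hc0 : (D₁.c : ℂ) ≠ 0 := gamma1_cast_c_ne_zero D₁
  have hc0' : (D₁'.c : ℂ) ≠ 0 := gamma1_cast_c_ne_zero D₁'
  have hcq : (D₁.c : ℚ) ≠ 0 := by exact_mod_cast (Int.cast_ne_zero.mp hc0)
  have hcq' : (D₁'.c : ℚ) ≠ 0 := by exact_mod_cast (Int.cast_ne_zero.mp hc0')
  have hlq : (D₁'.c : ℚ) / (D₁.c : ℚ) ≠ 0 := div_ne_zero hcq' hcq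
  have hl0 : ((D₁'.c : ℂ) / (D₁.c : ℂ)) ≠ 0 := div_ne_zero hc0' hc0
  have hIsq : Complex.I ^ 2 = ((((-1 : ℤ) : ℚ) : ℚ) : ℂ) := by push_cast; exact Complex.I_sq
  have hLT := isNeronLatticeOf_quadraticTwist_of_sq_eq ((-1 : ℤ) : ℚ) D₁.isNeronLattice
    Complex.I_ne_zero hIsq
  have hΛ' := gamma1_neronLattice_eq_mulLeft_of_rotation D₁ D₁' h₁ h₁' hrot hl0
  have hS' : (D₁'.L.lattice : Set ℂ) = (((D₁'.c : ℚ) / (D₁.c : ℚ) : ℚ) : ℂ) •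
      ((D₁.L.mulLeft (Complex.I)⁻¹ (inv_ne_zero Complex.I_ne_zero)).lattice.toAddSubgroup :
        Set ℂ) := by
    rw [hΛ', coe_mulLeft_lattice_eq_smul, Submodule.coe_toAddSubgroup]
    push_cast
    rfl
  have hST : ((D₁.L.mulLeft (Complex.I)⁻¹ (inv_ne_zero Complex.I_ne_zero)).lattice : Set ℂ) =
      ((1 : ℚ) : ℂ) • ((D₁.L.mulLeft (Complex.I)⁻¹ (inv_ne_zero Complex.I_ne_zero)).lattice.toAddSubgroup :
        Set ℂ) := by
    rw [Rat.cast_one, one_smul, Submodule.coe_toAddSubgroup]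
  obtain ⟨a₄, a₆, C₁, hW', hg₂, hg₃⟩ :=
    exists_shortModel_of_lattice_eq_smul D₁'.isNeronLattice hlq hS' (L' := _) rfl
  obtain ⟨a₄', a₆', C₂, hT, hg₂', hg₃'⟩ :=
    exists_shortModel_of_lattice_eq_smul hLT one_ne_zero hST (L' := _) rfl
  have ha₄ : a₄' = a₄ := by
    have h : (-4 : ℂ) * a₄' = -4 * a₄ := hg₂'.symm.trans hg₂
    exact_mod_cast mul_left_cancel₀ (by norm_num : (-4 : ℂ) ≠ 0) h
  have ha₆ : a₆' = a₆ := by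
    have h : (-4 : ℂ) * a₆' = -4 * a₆ := hg₃'.symm.trans hg₃
    exact_mod_cast mul_left_cancel₀ (by norm_num : (-4 : ℂ) ≠ 0) h
  rw [ha₄, ha₆] at hT
  exact ⟨C₁⁻¹ * C₂, by rw [mul_smul, hT, ← hW', inv_smul_smul]⟩

/-- **The Stevens–discriminant identity from a `Γ₁` rotation**: OPTIMAL `D₁`, `D₁′` with `Λ₁(f_{D₁′}) = i·Λ₁(f_{D₁})` ⟹
`c₁′¹²·Δ(W₁′) = c₁¹²·Δ(W₁)`. [cite: Stevens1989, §2] -/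
theorem gamma1_c_pow_twelve_mul_Δ_eq_of_rotation (D₁ : Gamma1ParametrizationData W₁ N)
    (D₁' : Gamma1ParametrizationData W₁' N') (h₁ : D₁.IsOptimal) (h₁' : D₁'.IsOptimal)
    (hrot : ∀ z : ℂ, z ∈ periodLatticeGamma1 D₁'.f ↔ Complex.I * z ∈ periodLatticeGamma1 D₁.f) :
    (D₁'.c : ℚ) ^ 12 * W₁'.Δ = (D₁.c : ℚ) ^ 12 * W₁.Δ := by
  have hc0 : (D₁.c : ℂ) ≠ 0 := gamma1_cast_c_ne_zero D₁
  have hc0' : (D₁'.c : ℂ) ≠ 0 := gamma1_cast_c_ne_zero D₁'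
  have hl0 : ((D₁'.c : ℂ) / (D₁.c : ℂ)) ≠ 0 := div_ne_zero hc0' hc0
  have hIsq : Complex.I ^ 2 = ((((-1 : ℤ) : ℚ) : ℚ) : ℂ) := by push_cast; exact Complex.I_sq
  have hLT := isNeronLatticeOf_quadraticTwist_of_sq_eq ((-1 : ℤ) : ℚ) D₁.isNeronLattice
    Complex.I_ne_zero hIsq
  have hΛ' := gamma1_neronLattice_eq_mulLeft_of_rotation D₁ D₁' h₁ h₁' hrot hl0
  have hΔ' := IsNeronLatticeOf.Δ_eq_of_lattice_eq_mulLeft D₁'.isNeronLattice hl0 hΛ'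
  have hΛT : (D₁.L.mulLeft (Complex.I)⁻¹ (inv_ne_zero Complex.I_ne_zero)).lattice =
      ((D₁.L.mulLeft (Complex.I)⁻¹ (inv_ne_zero Complex.I_ne_zero)).mulLeft 1 one_ne_zero).lattice := by
    ext z
    rw [PeriodPair.mem_mulLeft_lattice (c := 1), inv_one, one_mul]
  have hΔT := IsNeronLatticeOf.Δ_eq_of_lattice_eq_mulLeft hLT one_ne_zero hΛT
  rw [one_pow, inv_one, one_mul, quadraticTwist_Δ] at hΔT
  push_cast at hΔT
  have key : ((D₁'.c : ℂ) / (D₁.c : ℂ)) ^ 12 * (W₁'.Δ : ℂ) = (W₁.Δ : ℂ) := by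
    rw [hΔ', ← mul_assoc, mul_inv_cancel₀ (pow_ne_zero _ hl0), one_mul, ← hΔT]; ring
  have key' : (D₁'.c : ℂ) ^ 12 * (W₁'.Δ : ℂ) = (D₁.c : ℂ) ^ 12 * (W₁.Δ : ℂ) := by
    rw [← key, div_pow, ← mul_assoc, mul_div_cancel₀ _ (pow_ne_zero _ hc0)]
  exact_mod_cast key'

/-- `|c₁′| = |c₁|` from a `Γ₁` rotation when the discriminants agree. [cite: Stevens1989, §2] -/
theorem gamma1_maninConstant_natAbs_eq_of_rotation [W₁.IsElliptic] (D₁ : Gamma1ParametrizationData W₁ N)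
    (D₁' : Gamma1ParametrizationData W₁' N') (h₁ : D₁.IsOptimal) (h₁' : D₁'.IsOptimal)
    (hrot : ∀ z : ℂ, z ∈ periodLatticeGamma1 D₁'.f ↔ Complex.I * z ∈ periodLatticeGamma1 D₁.f) (hΔ : W₁'.Δ = W₁.Δ) :
    D₁'.maninConstant.natAbs = D₁.maninConstant.natAbs := by
  have h := gamma1_c_pow_twelve_mul_Δ_eq_of_rotation D₁ D₁' h₁ h₁' hrot
  rw [hΔ] at h
  have h12 : (D₁'.c : ℚ) ^ 12 = (D₁.c : ℚ) ^ 12 := mul_right_cancel₀ W₁.isUnit_Δ.ne_zero h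
  have h12' : D₁'.c ^ 12 = D₁.c ^ 12 := by exact_mod_cast h12
  have habs : D₁'.c.natAbs ^ 12 = D₁.c.natAbs ^ 12 := by
    rw [← Int.natAbs_pow, ← Int.natAbs_pow, h12']
  exact Nat.pow_left_injective (by norm_num) habs

end Rotation

/-! ## §8 The `χ₋₄` edge `N ∣ N′ ∣ 4N`, `16 ∣ N′`: Stevens' curve of the twisted class is the twist of Stevens' curve -/

section Edge

variable {W W' W₁ W₁' : WeierstrassCurve ℚ} [W.IsElliptic] [W'.IsElliptic] [W₁.IsElliptic] [W₁'.IsElliptic]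
  {N N' : ℕ} [NeZero N] [NeZero N']

/-- The `Γ₁` rotation read on the `X₁`-data of isogenous curves: `Λ₁(f_{D₁′}) = i·Λ₁(f_{D₁})` (newforms of isogenous curves coincide). -/
theorem periodLatticeGamma1_rotation_of_negOne_twist_of_dvd_gamma1 (D : ModularParametrizationData W N)
    (D' : ModularParametrizationData W' N') (D₁ : Gamma1ParametrizationData W₁ N) (D₁' : Gamma1ParametrizationData W₁' N')
    (hiso₁ : IsIsogenous W₁ W) (hiso₁' : IsIsogenous W₁' W')
    (hNN' : N ∣ N') (hN'4 : N' ∣ 4 * N) (h16 : 4 ^ 2 ∣ N')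
    (h4W : 2 ^ 2 ∣ W.conductorNorm ℤ) (h4W' : 2 ^ 2 ∣ W'.conductorNorm ℤ)
    (hiso : IsIsogenous (W.quadraticTwist ((-1 : ℤ) : ℚ)) W') :
    ∀ z : ℂ, z ∈ periodLatticeGamma1 D₁'.f ↔ Complex.I * z ∈ periodLatticeGamma1 D₁.f := by
  rw [D₁.f_eq_of_isIsogenous D hiso₁, D₁'.f_eq_of_isIsogenous D' hiso₁']
  exact periodLatticeGamma1_rotation_of_negOne_twist_of_dvd D D' hNN' hN'4 h16 h4W h4W' hiso

/-- **STEVENS' CURVE OF THE TWISTED CLASS IS THE TWIST OF STEVENS' CURVE**: along a `χ₋₄` edge `N ∣ N′ ∣ 4N`, `16 ∣ N′` (both curves additive at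
`2`), the optimal `X₁(N′)`-curve `W₁′` of the class of `W′ ~ W ⊗ χ₋₄` and the optimal `X₁(N)`-curve `W₁` of the class of `W` satisfy
`W₁′ ≅ W₁ ⊗ χ₋₄` over `ℚ`. [cite: Stevens1989, §2] -/
theorem stevensOptimalTwistRigidity_of_negOne_twist_of_dvd (D : ModularParametrizationData W N)
    (D' : ModularParametrizationData W' N') (D₁ : Gamma1ParametrizationData W₁ N) (D₁' : Gamma1ParametrizationData W₁' N')
    (hiso₁ : IsIsogenous W₁ W) (hiso₁' : IsIsogenous W₁' W') (h₁ : D₁.IsOptimal) (h₁' : D₁'.IsOptimal)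
    (hNN' : N ∣ N') (hN'4 : N' ∣ 4 * N) (h16 : 4 ^ 2 ∣ N')
    (h4W : 2 ^ 2 ∣ W.conductorNorm ℤ) (h4W' : 2 ^ 2 ∣ W'.conductorNorm ℤ)
    (hiso : IsIsogenous (W.quadraticTwist ((-1 : ℤ) : ℚ)) W') :
    ∃ u : VariableChange ℚ, u • W₁.quadraticTwist ((-1 : ℤ) : ℚ) = W₁' :=
  gamma1OptimalTwistRigidity_of_rotation D₁ D₁' h₁ h₁'
    (periodLatticeGamma1_rotation_of_negOne_twist_of_dvd_gamma1 D D' D₁ D₁' hiso₁ hiso₁' hNN' hN'4 h16 h4W h4W' hiso)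

/-- **`c₁′¹²·Δ(W₁′) = c₁¹²·Δ(W₁)` along the edge** (the Stevens–discriminant identity across levels). [cite: Stevens1989, §2] -/
theorem gamma1_c_pow_twelve_mul_Δ_eq_of_negOne_twist_of_dvd (D : ModularParametrizationData W N)
    (D' : ModularParametrizationData W' N') (D₁ : Gamma1ParametrizationData W₁ N) (D₁' : Gamma1ParametrizationData W₁' N')
    (hiso₁ : IsIsogenous W₁ W) (hiso₁' : IsIsogenous W₁' W') (h₁ : D₁.IsOptimal) (h₁' : D₁'.IsOptimal)
    (hNN' : N ∣ N') (hN'4 : N' ∣ 4 * N) (h16 : 4 ^ 2 ∣ N')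
    (h4W : 2 ^ 2 ∣ W.conductorNorm ℤ) (h4W' : 2 ^ 2 ∣ W'.conductorNorm ℤ)
    (hiso : IsIsogenous (W.quadraticTwist ((-1 : ℤ) : ℚ)) W') :
    (D₁'.c : ℚ) ^ 12 * W₁'.Δ = (D₁.c : ℚ) ^ 12 * W₁.Δ :=
  gamma1_c_pow_twelve_mul_Δ_eq_of_rotation D₁ D₁' h₁ h₁'
    (periodLatticeGamma1_rotation_of_negOne_twist_of_dvd_gamma1 D D' D₁ D₁' hiso₁ hiso₁' hNN' hN'4 h16 h4W h4W' hiso)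

/-- **`|c₁′| = |c₁|` along the edge when `Δ(W₁′) = Δ(W₁)`** — Stevens' `Γ₁`-constant (whose `2`-part on blind core classes is C2's stub 6♭‴) is a
`χ₋₄`-orbit invariant modulo the local discriminant clause. [cite: Stevens1989, §2] -/
theorem gamma1_maninConstant_natAbs_eq_of_negOne_twist_of_dvd (D : ModularParametrizationData W N)
    (D' : ModularParametrizationData W' N') (D₁ : Gamma1ParametrizationData W₁ N) (D₁' : Gamma1ParametrizationData W₁' N')
    (hiso₁ : IsIsogenous W₁ W) (hiso₁' : IsIsogenous W₁' W') (h₁ : D₁.IsOptimal) (h₁' : D₁'.IsOptimal)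
    (hNN' : N ∣ N') (hN'4 : N' ∣ 4 * N) (h16 : 4 ^ 2 ∣ N')
    (h4W : 2 ^ 2 ∣ W.conductorNorm ℤ) (h4W' : 2 ^ 2 ∣ W'.conductorNorm ℤ)
    (hiso : IsIsogenous (W.quadraticTwist ((-1 : ℤ) : ℚ)) W') (hΔ : W₁'.Δ = W₁.Δ) :
    D₁'.maninConstant.natAbs = D₁.maninConstant.natAbs :=
  gamma1_maninConstant_natAbs_eq_of_rotation D₁ D₁' h₁ h₁'
    (periodLatticeGamma1_rotation_of_negOne_twist_of_dvd_gamma1 D D' D₁ D₁' hiso₁ hiso₁' hNN' hN'4 h16 h4W h4W' hiso) hΔ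

/-- **`2 ∣ c₁′ ↔ 2 ∣ c₁` along the edge when `Δ(W₁′) = Δ(W₁)`**: the `2`-part of Stevens' conjecture transfers. -/
theorem two_dvd_gamma1_maninConstant_iff_of_negOne_twist_of_dvd (D : ModularParametrizationData W N)
    (D' : ModularParametrizationData W' N') (D₁ : Gamma1ParametrizationData W₁ N) (D₁' : Gamma1ParametrizationData W₁' N')
    (hiso₁ : IsIsogenous W₁ W) (hiso₁' : IsIsogenous W₁' W') (h₁ : D₁.IsOptimal) (h₁' : D₁'.IsOptimal)
    (hNN' : N ∣ N') (hN'4 : N' ∣ 4 * N) (h16 : 4 ^ 2 ∣ N')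
    (h4W : 2 ^ 2 ∣ W.conductorNorm ℤ) (h4W' : 2 ^ 2 ∣ W'.conductorNorm ℤ)
    (hiso : IsIsogenous (W.quadraticTwist ((-1 : ℤ) : ℚ)) W') (hΔ : W₁'.Δ = W₁.Δ) :
    (2 : ℤ) ∣ D₁'.maninConstant ↔ (2 : ℤ) ∣ D₁.maninConstant := by
  have habs := gamma1_maninConstant_natAbs_eq_of_negOne_twist_of_dvd D D' D₁ D₁' hiso₁ hiso₁' h₁ h₁' hNN' hN'4 h16 h4W h4W' hiso hΔ
  rw [← Int.natAbs_dvd_natAbs, ← Int.natAbs_dvd_natAbs (a := 2), habs]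

end Edge

end Summit.BirchSwinnertonDyer.BirchSwinnertonDyer.Theorems.ManinLocalTwoThree.SigmaHabitat

end
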